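import Mathlib.Algebra.Polynomial.Roots
import Literature.RepresentationTheory.SymmetricPowerBinaryForms
import Literature.RepresentationTheory.FiniteGroups.GL2ModularPrincipalSeriesInvariants
import HarnessLib

/-!
# The embedding `Sym^r k² ⊗ (χ₁ ∘ det) ↪ Ind_B^{GL₂(F)}(χ₁ ⊗ χ₁·(·)^r)` — evaluating binary forms on the
# second row

Topic `Literature/RepresentationTheory/FiniteGroups`, namespace `Literature.RepresentationTheory.FiniteGroups.GL2`
(sequel of `GL2ModularPrincipalSeriesInvariants`; uses the binary-forms model `symPowGL`, `dehom₀`, `dehom₁` of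
`Literature/RepresentationTheory/SymmetricPowerBinaryForms`).  DEFINITIONS (`rowPt`, `symPowToPrincipalSeries`,
`symPowTwist`, `symPowSubrep`) + API (reviewed kind); no named fact, no instance, no notation, no `sorry`.
(Coefficient note: the defining file `GL2ModularPrincipalSeries` now allows any commutative coefficient ring — the integral structure `Fun_R(Ind(χ₁ ⊗ χ₂))` of `GL2ModularPrincipalSeriesBruhatBasis` / `…Reduction` —; this file keeps `k` a field.)

Source: M. Emerton, T. Gee, D. Savitt, *Lattices in the cohomology of Shimura curves* [EmertonGeeSavitt2015]
§3.2 "Principal series types" (held `paper:arxiv-1305.1594`, p0011–p0012): for characters `η ≠ η'` of `k_v^×`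
with `η η'⁻¹ = [·]^c`, `σ(χ) := Ind χ^s`, «The Jordan–Hölder factors of `σ̄(χ)` are parameterised … (see Lemma
2.2 of [Breuil–Paškūnas, *Towards a modulo `p` Langlands correspondence for GL₂*] or Proposition 1.1 of
[Diamond])»; for `f = 1` they are `σ̄(χ)_∅ = Sym^c ⊗ η'∘det` and `σ̄(χ)_{{0}} = det^c Sym^{p−1−c} ⊗ η'∘det`.
In the dictionary of this file: `η' = χ₁`, `η = χ₂ = χ₁ · f^r` (`f : F →+* k` the coefficient map on units),
`c = r`, and `σ̄(χ)_∅` is realised as the explicit subrepresentation `symPowSubrep` = image of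

  `Φ : Sym^r k² → 𝓑(χ₁, χ₂)`, `Φ(P)(x) = χ₁(det x) · P(f(x₁₀), f(x₁₁))`

(a binary form of degree `r` evaluated on the second row; `row₁(bx) = b₁₁ row₁(x)` gives the covariance
`Φ(P)(bx) = χ₁(det b) f(b₁₁)^r Φ(P)(x) = χ(b) Φ(P)(x)`).  D. Bump [Bump1997] §4.1 for `B`, `χ`, `𝓑(χ₁, χ₂)`;
J. E. Humphreys [Humphreys2005] §19.2 for the binary-forms model.

## What is defined / proved (`F : Type` a field, `k` a field, `f : F →+* k`, `hχ : χ₂(a) = χ₁(a) f(a)^r`)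

* `symPowToPrincipalSeries f χ₁ χ₂ r hχ : homogeneousSubmodule (Fin 2) k r →ₗ[k] 𝓑(χ₁, χ₂)` (`Φ`) and its
  **twisted equivariance** `symPowToPrincipalSeries_symPowGL`: `h · Φ(P) = Φ(χ₁(det h) · Sym^r(h) P)`;
* `symPowTwist f χ₁ r` — the representation `Sym^r ⊗ (χ₁ ∘ det)` of `GL₂(F)`;
* for finite `F` with `r < #F`: `Φ` is **injective** (`symPowToPrincipalSeries_injective`: a form vanishing at the
  `#F` points `(f t, 1)` is `0`, via `dehom₀`) and **`f₁ ∉ range Φ`** (`deltaBorel_not_mem_range`, via `dehom₁`);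
* `symPowSubrep f χ₁ χ₂ r hχ : Subrepresentation (principalSeriesRep F χ₁ χ₂)` — the image, with
  `symPowSubrep_ne_bot`, `symPowSubrep_ne_top` (`r < #F`).

The socle statement (`𝔽_p`, `χ₁ ≠ χ₂`) is the sequel `GL2ModularPrincipalSeriesSocle`.
-/

noncomputable section

namespace Literature.RepresentationTheory.FiniteGroups

namespace GL2

open Matrix

section SymPowEmbedding

open MvPolynomial

variable {F : Type} [Field F] [DecidableEq F] {k : Type*} [Field k] (f : F →+* k)
  (χ₁ χ₂ : Fˣ →* kˣ) (r : ℕ)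

omit [DecidableEq F] in
/-- Evaluation of a form of degree `n` is homogeneous of degree `n` in the point. [cite: Humphreys2005, §19.2 p.198] -/
theorem eval_smul_of_mem_homogeneousSubmodule {σ : Type*} [Fintype σ] {n : ℕ}
    {φ : MvPolynomial σ k} (hφ : φ ∈ homogeneousSubmodule σ k n) (c : k) (v : σ → k) :
    MvPolynomial.eval (c • v) φ = c ^ n * MvPolynomial.eval v φ := by
  rw [mem_homogeneousSubmodule] at hφ
  rw [MvPolynomial.eval_eq, MvPolynomial.eval_eq, Finset.mul_sum]
  refine Finset.sum_congr rfl fun d hd => ?_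
  have hdeg : ∑ i ∈ d.support, d i = n := (hφ.degree_eq_sum_deg_support hd).symm
  simp only [Pi.smul_apply, smul_eq_mul, mul_pow, Finset.prod_mul_distrib, Finset.prod_pow_eq_pow_sum,
    hdeg]
  ring

/-- The second row of `x`, pushed into `k²` along `f` (`B x ↦ [row₁ x]` identifies `B\G` with `ℙ¹`). [cite: EmertonGeeSavitt2015, §3.2] -/
def rowPt (x : GL (Fin 2) F) : Fin 2 → k := fun j => f ((x : Matrix (Fin 2) (Fin 2) F) 1 j)

omit [DecidableEq F] in
/-- `row₁(b x) = b₁₁ · row₁(x)` for `b ∈ B`. [cite: EmertonGeeSavitt2015, §3.2] -/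
theorem rowPt_borel_mul (b : borel F) (x : GL (Fin 2) F) :
    rowPt f ((b : GL (Fin 2) F) * x) = f (((b : GL (Fin 2) F) : Matrix (Fin 2) (Fin 2) F) 1 1) • rowPt f x := by
  funext j
  simp only [rowPt, Pi.smul_apply, smul_eq_mul]
  rw [Matrix.GeneralLinearGroup.coe_mul, Matrix.mul_apply, Fin.sum_univ_two, (mem_borel_iff _).mp b.2,
    zero_mul, zero_add, map_mul]

omit [DecidableEq F] in
/-- `row₁(x h) = row₁(x) · h`. [cite: EmertonGeeSavitt2015, §3.2] -/
theorem rowPt_mul (x h : GL (Fin 2) F) :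
    rowPt f (x * h) = Matrix.vecMul (rowPt f x) ((h : Matrix (Fin 2) (Fin 2) F).map f) := by
  funext j
  simp only [rowPt, Matrix.vecMul, dotProduct, Matrix.map_apply, Fin.sum_univ_two]
  rw [Matrix.GeneralLinearGroup.coe_mul, Matrix.mul_apply, Fin.sum_univ_two, map_add, map_mul, map_mul]

omit [DecidableEq F] in
/-- Evaluating a linearly substituted form: `(M • φ)(v) = φ(v · M)`. [cite: Humphreys2005, §19.2 p.198] -/
theorem eval_mvPolynomialSubst {σ : Type*} [Fintype σ] (M : Matrix σ σ k) (φ : MvPolynomial σ k) (v : σ → k) :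
    MvPolynomial.eval v (mvPolynomialSubst M φ) = MvPolynomial.eval (Matrix.vecMul v M) φ := by
  rw [mvPolynomialSubst_def]
  change MvPolynomial.eval₂Hom (RingHom.id k) v (bind₁ _ φ) = _
  rw [MvPolynomial.eval₂Hom_bind₁]
  change MvPolynomial.eval (fun j => MvPolynomial.eval v (∑ i, C (M i j) * X i)) φ = _
  have : (fun j => MvPolynomial.eval v (∑ i, C (M i j) * X i)) = Matrix.vecMul v M := by
    funext j
    simp [Matrix.vecMul, dotProduct, mul_comm]
  rw [this]

omit [DecidableEq F] in
/-- `det b = b₀₀ b₁₁` as units, for `b ∈ B`. [cite: Bump1997, §4.1 Eq. (1.6)] -/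
theorem det_eq_borelFst_mul_borelSnd (b : borel F) :
    Matrix.GeneralLinearGroup.det (b : GL (Fin 2) F) = borelFst b * borelSnd b :=
  Units.ext (by
    rw [Matrix.GeneralLinearGroup.val_det_apply, Units.val_mul, coe_borelFst, coe_borelSnd]
    exact det_eq_of_mem_borel b.2)

/-- **The map `Φ : Sym^r k² ⊗ (χ₁ ∘ det) → Ind_B^{GL₂(F)}(χ₁ ⊗ χ₂)`** for `χ₂ = χ₁ · f^r` (`f : F → k` the
coefficient map): `Φ(P)(x) = χ₁(det x) · P(f(x₁₀), f(x₁₁))` — evaluate the binary form `P` of degree `r` on the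
second row of `x`.  Realises the constituent `σ̄(χ)_∅ = Sym^r ⊗ η'∘det` of [EGS §3.2] (`η' = χ₁`, `c = r`) inside
the principal series. [cite: EmertonGeeSavitt2015, §3.2] -/
def symPowToPrincipalSeries (hχ : ∀ a : Fˣ, (χ₂ a : k) = (χ₁ a : k) * f a ^ r) :
    homogeneousSubmodule (Fin 2) k r →ₗ[k]
      Representation.coindV (borel F).subtype (scalarRep (borelCharacter F χ₁ χ₂)) where
  toFun φ := ⟨fun x => (χ₁ (Matrix.GeneralLinearGroup.det x) : k) *
      MvPolynomial.eval (rowPt f x) (φ : MvPolynomial (Fin 2) k), by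
    rw [mem_principalSeriesRep_iff]
    intro b x
    rw [map_mul, map_mul, Units.val_mul, rowPt_borel_mul, eval_smul_of_mem_homogeneousSubmodule φ.2,
      borelCharacter_apply, Units.val_mul, hχ, det_eq_borelFst_mul_borelSnd, map_mul, Units.val_mul, coe_borelSnd]
    ring⟩
  map_add' φ ψ := by
    refine Subtype.ext (funext fun x => ?_)
    simp only [Submodule.coe_add, map_add, Pi.add_apply]
    ring
  map_smul' c φ := by
    refine Subtype.ext (funext fun x => ?_)
    simp only [Submodule.coe_smul, MvPolynomial.smul_eval, RingHom.id_apply, Pi.smul_apply, smul_eq_mul]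
    ring

/-- The twisted symmetric power `Sym^r ⊗ (χ₁ ∘ det)` of `GL₂(F)` on binary forms of degree `r` over `k`
(`h ↦ χ₁(det h) · symPowGL f r h`). [cite: EmertonGeeSavitt2015, §3.2] -/
def symPowTwist : Representation k (GL (Fin 2) F) (homogeneousSubmodule (Fin 2) k r) where
  toFun h := (χ₁ (Matrix.GeneralLinearGroup.det h) : k) • symPowGL f r h
  map_one' := by rw [map_one, map_one, Units.val_one, one_smul, map_one]
  map_mul' g h := by
    rw [map_mul, map_mul, Units.val_mul, map_mul, smul_mul_smul_comm]

omit [DecidableEq F] in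
/-- Unfolding lemma. [cite: EmertonGeeSavitt2015, §3.2] -/
theorem symPowTwist_apply (h : GL (Fin 2) F) (φ : homogeneousSubmodule (Fin 2) k r) :
    symPowTwist f χ₁ r h φ = (χ₁ (Matrix.GeneralLinearGroup.det h) : k) • symPowGL f r h φ := rfl

variable {f χ₁ χ₂ r}

omit [DecidableEq F] in
/-- `Φ(P)(x) = χ₁(det x) · P(f row₁ x)`. [cite: EmertonGeeSavitt2015, §3.2] -/
theorem symPowToPrincipalSeries_apply_coe (hχ : ∀ a : Fˣ, (χ₂ a : k) = (χ₁ a : k) * f a ^ r)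
    (φ : homogeneousSubmodule (Fin 2) k r) (x : GL (Fin 2) F) :
    (symPowToPrincipalSeries f χ₁ χ₂ r hχ φ : GL (Fin 2) F → k) x =
      (χ₁ (Matrix.GeneralLinearGroup.det x) : k) * MvPolynomial.eval (rowPt f x) (φ : MvPolynomial (Fin 2) k) :=
  rfl

omit [DecidableEq F] in
/-- **Twisted equivariance**: `Φ(Sym^r(h) φ) = χ₁(det h)⁻¹ · (h · Φ(φ))`, i.e. `Φ` intertwines
`Sym^r ⊗ (χ₁ ∘ det)` (`symPowTwist`) with the principal series. [cite: EmertonGeeSavitt2015, §3.2] -/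
theorem symPowToPrincipalSeries_symPowGL (hχ : ∀ a : Fˣ, (χ₂ a : k) = (χ₁ a : k) * f a ^ r)
    (h : GL (Fin 2) F) (φ : homogeneousSubmodule (Fin 2) k r) :
    principalSeriesRep F χ₁ χ₂ h (symPowToPrincipalSeries f χ₁ χ₂ r hχ φ) =
      symPowToPrincipalSeries f χ₁ χ₂ r hχ
        ((χ₁ (Matrix.GeneralLinearGroup.det h) : k) • symPowGL f r h φ) := by
  refine Subtype.ext (funext fun x => ?_)
  rw [principalSeriesRep_apply_coe, symPowToPrincipalSeries_apply_coe, symPowToPrincipalSeries_apply_coe,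
    Submodule.coe_smul, MvPolynomial.smul_eval, coe_symPowGL_apply, eval_mvPolynomialSubst, ← rowPt_mul,
    map_mul, map_mul, Units.val_mul]
  ring

/-- In coordinates: `P(a, 1) = P(X, 1)(a)` (`dehom₀`). [cite: Humphreys2005, §19.2 p.198] -/
theorem eval_dehom₀ (φ : MvPolynomial (Fin 2) k) (a : k) :
    Polynomial.eval a (dehom₀ φ) = MvPolynomial.eval ![a, 1] φ := by
  have : (Polynomial.aeval a : Polynomial k →ₐ[k] k).comp dehom₀ = MvPolynomial.aeval ![a, 1] := by
    refine MvPolynomial.algHom_ext fun j => ?_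
    fin_cases j <;> simp
  have h := congrArg (fun ψ => ψ φ) this
  simp only [AlgHom.comp_apply, Polynomial.coe_aeval_eq_eval] at h
  exact h

/-- In coordinates: `P(1, a) = P(1, X)(a)` (`dehom₁`). [cite: Humphreys2005, §19.2 p.198] -/
theorem eval_dehom₁ (φ : MvPolynomial (Fin 2) k) (a : k) :
    Polynomial.eval a (dehom₁ φ) = MvPolynomial.eval ![1, a] φ := by
  have : (Polynomial.aeval a : Polynomial k →ₐ[k] k).comp dehom₁ = MvPolynomial.aeval ![1, a] := by
    refine MvPolynomial.algHom_ext fun j => ?_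
    fin_cases j <;> simp
  have h := congrArg (fun ψ => ψ φ) this
  simp only [AlgHom.comp_apply, Polynomial.coe_aeval_eq_eval] at h
  exact h

omit [DecidableEq F] in
/-- `row₁(v(t)) = (t, 1)`. [cite: EmertonGeeSavitt2015, §3.2] -/
theorem rowPt_lowerUnip (t : F) : rowPt f (lowerUnip F t) = ![f t, 1] := by
  funext j; fin_cases j <;> simp [rowPt]

omit [DecidableEq F] in
/-- `row₁(w u(t)) = (1, t)`. [cite: EmertonGeeSavitt2015, §3.2] -/
theorem rowPt_weyl_mul_upperUnip (t : F) : rowPt f (weyl F * upperUnip F t) = ![1, f t] := by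
  funext j
  fin_cases j <;>
    simp [rowPt, coe_weyl, Matrix.mul_apply, Fin.sum_univ_two]

omit [DecidableEq F] in
/-- `det v(t) = 1`. [cite: Bump1997, §4.1 Eq. (1.7)] -/
theorem det_lowerUnip (t : F) : Matrix.GeneralLinearGroup.det (lowerUnip F t) = 1 :=
  Units.ext (by simp [Matrix.GeneralLinearGroup.val_det_apply, Matrix.det_fin_two_of])

omit [DecidableEq F] in
/-- **`Φ` is injective** as soon as `r < #F`: a form of degree `r` vanishing at the `#F` points
`(f t, 1)` is zero. [cite: EmertonGeeSavitt2015, §3.2] -/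
theorem symPowToPrincipalSeries_injective [Fintype F] (hχ : ∀ a : Fˣ, (χ₂ a : k) = (χ₁ a : k) * f a ^ r)
    (hr : r < Fintype.card F) : Function.Injective (symPowToPrincipalSeries f χ₁ χ₂ r hχ) := by
  rw [injective_iff_map_eq_zero]
  intro φ hφ
  have hval : ∀ t : F, Polynomial.eval (f t) (dehom₀ (φ : MvPolynomial (Fin 2) k)) = 0 := by
    intro t
    have := congrArg (fun g : Representation.coindV (borel F).subtype (scalarRep (borelCharacter F χ₁ χ₂)) =>
      (g : GL (Fin 2) F → k) (lowerUnip F t)) hφ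
    simp only [symPowToPrincipalSeries_apply_coe, det_lowerUnip, map_one, Units.val_one, one_mul,
      rowPt_lowerUnip, Submodule.coe_zero, Pi.zero_apply] at this
    rwa [eval_dehom₀]
  have h0 : dehom₀ (φ : MvPolynomial (Fin 2) k) = 0 :=
    Polynomial.eq_zero_of_natDegree_lt_card_of_eval_eq_zero _ f.injective hval
      ((natDegree_dehom₀_le φ.2).trans_lt hr)
  exact Subtype.ext (eq_zero_of_dehom₀_eq_zero φ.2 h0)

/-- **`f₁` is not in the image of `Φ`** (for `r < #F`): on the big cell `Φ(F)` is `χ₁(det)·F(1, t)`, a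
polynomial in `t` of degree `≤ r`, which cannot vanish at all `#F` points unless `P = 0`. [cite: EmertonGeeSavitt2015, §3.2] -/
theorem deltaBorel_not_mem_range [Fintype F] (hχ : ∀ a : Fˣ, (χ₂ a : k) = (χ₁ a : k) * f a ^ r)
    (hr : r < Fintype.card F) :
    deltaBorel χ₁ χ₂ ∉ LinearMap.range (symPowToPrincipalSeries f χ₁ χ₂ r hχ) := by
  rintro ⟨φ, hφ⟩
  have hval : ∀ t : F, Polynomial.eval (f t) (dehom₁ (φ : MvPolynomial (Fin 2) k)) = 0 := by
    intro t
    have := congrArg (fun g : Representation.coindV (borel F).subtype (scalarRep (borelCharacter F χ₁ χ₂)) =>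
      (g : GL (Fin 2) F → k) (weyl F * upperUnip F t)) hφ
    have hnot : weyl F * upperUnip F t ∉ borel F := by
      rw [mem_borel_iff]
      change ¬ ((weyl F : Matrix (Fin 2) (Fin 2) F) * (upperUnip F t : Matrix (Fin 2) (Fin 2) F)) 1 0 = 0
      rw [coe_weyl, coe_upperUnip]
      simp [Matrix.mul_apply, Fin.sum_univ_two]
    simp only [symPowToPrincipalSeries_apply_coe, rowPt_weyl_mul_upperUnip,
      deltaBorel_apply_of_not_mem χ₁ χ₂ hnot] at this
    rw [eval_dehom₁]
    exact (mul_eq_zero.mp this).resolve_left (Units.ne_zero _)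
  have h0 : dehom₁ (φ : MvPolynomial (Fin 2) k) = 0 :=
    Polynomial.eq_zero_of_natDegree_lt_card_of_eval_eq_zero _ f.injective hval
      ((natDegree_dehom₁_le φ.2).trans_lt hr)
  have hφ0 : φ = 0 := Subtype.ext (eq_zero_of_dehom₁_eq_zero φ.2 h0)
  rw [hφ0, map_zero] at hφ
  exact deltaBorel_ne_zero χ₁ χ₂ hφ.symm

variable (f χ₁ χ₂ r) in
/-- **The subrepresentation `Sym^r ⊗ (χ₁ ∘ det) ⊂ Ind_B^G(χ₁ ⊗ χ₂)`** (`χ₂ = χ₁ f^r`): the image of `Φ`, stable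
by the twisted equivariance. [cite: EmertonGeeSavitt2015, §3.2] -/
def symPowSubrep (hχ : ∀ a : Fˣ, (χ₂ a : k) = (χ₁ a : k) * f a ^ r) :
    Subrepresentation (principalSeriesRep F χ₁ χ₂) :=
  ⟨LinearMap.range (symPowToPrincipalSeries f χ₁ χ₂ r hχ), by
    rintro h _ ⟨φ, rfl⟩
    rw [symPowToPrincipalSeries_symPowGL]
    exact LinearMap.mem_range_self _ _⟩

omit [DecidableEq F] in
/-- Unfolding lemma. [cite: EmertonGeeSavitt2015, §3.2] -/
theorem symPowSubrep_toSubmodule (hχ : ∀ a : Fˣ, (χ₂ a : k) = (χ₁ a : k) * f a ^ r) :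
    (symPowSubrep f χ₁ χ₂ r hχ).toSubmodule = LinearMap.range (symPowToPrincipalSeries f χ₁ χ₂ r hχ) := rfl

omit [DecidableEq F] in
/-- Membership in the image of `Φ`. [cite: EmertonGeeSavitt2015, §3.2] -/
theorem mem_symPowSubrep_iff (hχ : ∀ a : Fˣ, (χ₂ a : k) = (χ₁ a : k) * f a ^ r)
    (g : Representation.coindV (borel F).subtype (scalarRep (borelCharacter F χ₁ χ₂))) :
    g ∈ symPowSubrep f χ₁ χ₂ r hχ ↔ ∃ φ, symPowToPrincipalSeries f χ₁ χ₂ r hχ φ = g := Iff.rfl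

/-- `Sym^r ⊗ (χ₁∘det)` is a PROPER subrepresentation (`f₁ ∉` it), for `r < #F`. [cite: EmertonGeeSavitt2015, §3.2] -/
theorem symPowSubrep_ne_top [Fintype F] (hχ : ∀ a : Fˣ, (χ₂ a : k) = (χ₁ a : k) * f a ^ r)
    (hr : r < Fintype.card F) : symPowSubrep f χ₁ χ₂ r hχ ≠ ⊤ := by
  intro h
  have : deltaBorel χ₁ χ₂ ∈ symPowSubrep f χ₁ χ₂ r hχ := by rw [h]; trivial
  exact deltaBorel_not_mem_range hχ hr this

omit [DecidableEq F] in
/-- `Sym^r ⊗ (χ₁∘det)` is a NONZERO subrepresentation, for `r < #F`. [cite: EmertonGeeSavitt2015, §3.2] -/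
theorem symPowSubrep_ne_bot [Fintype F] (hχ : ∀ a : Fˣ, (χ₂ a : k) = (χ₁ a : k) * f a ^ r)
    (hr : r < Fintype.card F) : symPowSubrep f χ₁ χ₂ r hχ ≠ ⊥ := by
  intro h
  have hX : (X 0 ^ r : MvPolynomial (Fin 2) k) ∈ homogeneousSubmodule (Fin 2) k r :=
    (mem_homogeneousSubmodule _ _).mpr (isHomogeneous_X_pow _ _)
  have hmem : symPowToPrincipalSeries f χ₁ χ₂ r hχ ⟨X 0 ^ r, hX⟩ ∈ symPowSubrep f χ₁ χ₂ r hχ :=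
    ⟨_, rfl⟩
  rw [h] at hmem
  have h0 : symPowToPrincipalSeries f χ₁ χ₂ r hχ ⟨X 0 ^ r, hX⟩ = 0 := hmem
  have := symPowToPrincipalSeries_injective hχ hr (h0.trans (map_zero _).symm)
  exact pow_ne_zero r (X_ne_zero (0 : Fin 2)) (congrArg Subtype.val this)

end SymPowEmbedding

end GL2

end Literature.RepresentationTheory.FiniteGroups

end
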